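import Mathlib.Analysis.Calculus.ParametricIntegral
import Mathlib.Analysis.Calculus.Deriv.Shift
import Mathlib.MeasureTheory.Integral.Bochner.Set
import Literature.NumberTheory.Automorphic.ArchimedeanCalculus
import HarnessLib

/-!
# Differentiation of parametric integrals along archimedean one-parameter subgroups
(Moeglin–Waldspurger (1995), I.2.10: the derivatives `d^h/dx^h` taken under the integral over the
compact quotient `V_{i-1}(𝔸)V_i(k)\V_i(𝔸)`; Borel (1997), Cor. 5.3: `D(f ∗ α) = f ∗ Dα`)

Topic `NumberTheory/Automorphic`; generic calculus for the archimedean variable of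
`ArchimedeanCalculus` (`H : RealMatrixGroup A N`, `ι : H → G`, the Lie derivative
`lieDeriv ι X φ g = d/dt φ (g · ι(exp tX))|_{t=0}`). For a family `F u : G → ℂ` indexed by a
compact probability-type space `(C, μ)` we PROVE that the average `Φ(g) = ∫ F u g dμ(u)` may be
differentiated along the flow `t ↦ g ι(exp tX)` under the integral sign, given pointwise flow
derivatives `F' u` that are jointly continuous — the elementary step, iterated `h` times, of the
integration by parts in Moeglin–Waldspurger's Lemma I.2.10 (there `C = k\𝔸`, and `F u g` is a
function of `u g`):

* `continuous_expMem_smul` — `t ↦ exp tX ∈ H` is continuous (cf. `RealMatrixGroup.continuous_expMem_smul`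
  of `AutomorphicFormsL2DerivativeIntegral`, not imported here);
* `hasDerivAt_flow_of_hasDerivAt_zero` — a flow derivative at `t = 0` at every base point gives the
  flow derivative at every `t` (`exp((t+s)X) = exp(tX) exp(sX)`);
* `IsArchSmooth.hasDerivAt_flow` — for `φ` smooth in the archimedean variable the flow derivative
  is the Lie derivative: `d/dt φ(g ι(exp tX)) = (X φ)(g ι(exp tX))`;
* `continuous_integral_of_continuous_uncurry` — `g ↦ ∫ F u g dμ(u)` is continuous when
  `(u, g) ↦ F u g` is (`C` compact, `G` locally compact; Mathlib
  `continuous_parametric_integral_of_continuous`);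
* `hasDerivAt_integral_flow` — **differentiation under the integral sign along the flow**:
  if `(u, g) ↦ F u g` and `(u, g) ↦ F' u g` are continuous and
  `d/dt F u (g ι(exp tX))|_{t=0} = F' u g` for all `u, g`, then
  `d/dt ∫ F u (g ι(exp tX)) dμ(u) |_{t=0} = ∫ F' u g dμ(u)`; hence
  `lieDeriv_integral_eq_integral` : `X (∫ F u · dμ) = ∫ F' u · dμ`.

## References

* C. Moeglin, J.-L. Waldspurger, *Spectral decomposition and Eisenstein series* (1995), I.2.10
  [MoeglinWaldspurger1995].
* A. Borel, *Automorphic forms on `SL₂(ℝ)`* (1997), 2.1, Cor. 5.3 [Borel1997].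
-/

noncomputable section

open _root_.MeasureTheory Set Filter Metric
open _root_.Topology
open scoped MatrixGroups Matrix ContDiff

namespace Literature.NumberTheory.Automorphic

variable {A : Type*} [NormedCommRing A] [NormedAlgebra ℝ A] [NormedAlgebra ℚ A] [CompleteSpace A]
  [StarRing A] {N : Type*} [Fintype N] [DecidableEq N] {H : RealMatrixGroup A N}
  {G : Type*} [Group G] (ι : H.carrier →* G)

/-! ### 1. The flow `t ↦ g ι(exp tX)` -/

section Flow

omit [StarRing A] in
set_option backward.isDefEq.respectTransparency false in
open scoped Matrix.Norms.Operator in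
/-- `t ↦ exp(tX) : ℝ → GL N A` is continuous (the exponential series is continuous and
`(exp tX)⁻¹ = exp(-tX)`); private copy of `continuous_expGL_smul` of
`AutomorphicFormsL2DerivativeIntegral`, which is not imported here (it sits above the `L²` theory).
Knapp, *Lie Groups Beyond an Introduction*, 0.§2. [folklore] -/
private theorem continuous_expGL_smul_aux (X : Matrix N N A) :
    Continuous fun t : ℝ => expGL (t • X) := by
  refine Units.continuous_iff.2 ⟨?_, ?_⟩
  · change Continuous fun t : ℝ => ((expGL (t • X) : GL N A) : Matrix N N A)
    simp only [coe_expGL]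
    exact NormedSpace.exp_continuous.comp (continuous_id.smul continuous_const)
  · have h : ∀ t : ℝ, (((expGL (t • X))⁻¹ : GL N A) : Matrix N N A) = NormedSpace.exp ((-t) • X) :=
      fun t => by rw [← expGL_neg, coe_expGL, neg_smul]
    change Continuous fun t : ℝ => (((expGL (t • X))⁻¹ : GL N A) : Matrix N N A)
    simp only [h]
    exact NormedSpace.exp_continuous.comp (continuous_neg.smul continuous_const)

/-- `t ↦ exp(tX) ∈ H` is continuous for `X ∈ 𝔤`. [folklore] -/
theorem continuous_expMem_smul (X : H.lie) : Continuous fun t : ℝ => H.expMem (t • X) := by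
  refine Continuous.subtype_mk ?_ _
  change Continuous fun t : ℝ => expGL (((t • X : H.lie) : Matrix N N A))
  have h : ∀ t : ℝ, (((t • X : H.lie) : Matrix N N A)) = t • (X : Matrix N N A) := fun t => rfl
  simp only [h]
  exact continuous_expGL_smul_aux (X : Matrix N N A)

/-- `exp ((s + t) X) = exp (s X) exp (t X)` in `H` (private copy of
`RealMatrixGroup.expMem_add_smul` of `AutomorphicFormsL2Derivative`, not imported here).
Knapp, 0.§2, Prop. 0.11 (c). [folklore] -/
private theorem expMem_add_smul' (s t : ℝ) (X : H.lie) :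
    H.expMem ((s + t) • X) = H.expMem (s • X) * H.expMem (t • X) := by
  refine Subtype.ext ?_
  change expGL (((s + t) • X : H.lie) : Matrix N N A) =
    expGL ((s • X : H.lie) : Matrix N N A) * expGL ((t • X : H.lie) : Matrix N N A)
  exact expGL_add_smul s t (X : Matrix N N A)

/-- `exp (0 · X) = 1` in `H` (private copy of `RealMatrixGroup.expMem_zero_smul` of
`AutomorphicFormsL2Derivative`, not imported here). [folklore] -/
private theorem expMem_zero_smul' (X : H.lie) : H.expMem ((0 : ℝ) • X) = 1 := by
  refine Subtype.ext ?_
  change expGL (((0 : ℝ) • X : H.lie) : Matrix N N A) = 1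
  have h0 : (((0 : ℝ) • X : H.lie) : Matrix N N A) = 0 := by
    change (0 : ℝ) • (X : Matrix N N A) = 0
    exact zero_smul _ _
  rw [h0, expGL_zero]

/-- **Flow derivatives propagate along the flow**: if `t ↦ ψ(y ι(exp tX))` has derivative `ψ' y` at
`t = 0` for every base point `y`, then `t ↦ ψ(g ι(exp tX))` has derivative `ψ'(g ι(exp sX))` at
every `s` (`g ι(exp tX) = (g ι(exp sX)) ι(exp (t-s)X)`). [folklore] -/
theorem hasDerivAt_flow_of_hasDerivAt_zero {ψ ψ' : G → ℂ} (X : H.lie)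
    (h : ∀ y : G, HasDerivAt (fun t : ℝ => ψ (y * ι (H.expMem (t • X)))) (ψ' y) 0)
    (g : G) (s : ℝ) :
    HasDerivAt (fun t : ℝ => ψ (g * ι (H.expMem (t • X)))) (ψ' (g * ι (H.expMem (s • X)))) s := by
  set g' : G := g * ι (H.expMem (s • X)) with hg'
  have h0 : HasDerivAt (fun t : ℝ => ψ (g' * ι (H.expMem (t • X)))) (ψ' g') (s - s) := by
    rw [sub_self]
    exact h g'
  have key : (fun t : ℝ => ψ (g * ι (H.expMem (t • X)))) =
      fun t => ψ (g' * ι (H.expMem ((t - s) • X))) := by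
    funext t
    rw [hg', mul_assoc, ← map_mul, ← expMem_add_smul', add_sub_cancel]
  rw [key]
  exact h0.comp_sub_const s s

open scoped Matrix.Norms.Operator in
/-- **The flow derivative of a smooth function is its Lie derivative** (at `t = 0`, by definition
of `lieDeriv`; the derivative exists because `Y ↦ φ(g ι(exp Y))` is smooth on `𝔤`).
Borel–Jacquet 1979, §1.5. [folklore] -/
theorem IsArchSmooth.hasDerivAt_flow_zero {φ : G → ℂ} (hφ : IsArchSmooth ι φ) (X : H.lie) (g : G) :
    HasDerivAt (fun t : ℝ => φ (g * ι (H.expMem (t • X)))) (lieDeriv ι X φ g) 0 := by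
  -- Mathlib idiom (Mathlib/Algebra/Lie/OfAssociative.lean), needed to name `𝔤.toSubmodule`
  letI : LieRing (Matrix N N A) := LieRing.ofAssociativeRing
  set v : H.lie.toSubmodule := ⟨X, X.2⟩ with hv
  have hd : DifferentiableAt ℝ (fun t : ℝ => φ (g * ι (H.expMem (t • X)))) 0 := by
    have hF : DifferentiableAt ℝ (fun Y : H.lie.toSubmodule => φ (g * ι (H.expMem ⟨Y, Y.2⟩)))
        ((fun t : ℝ => t • v) 0) := by
      have h0 : (fun t : ℝ => t • v) 0 = 0 := zero_smul _ _
      rw [h0]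
      exact ((hφ g).differentiable (by simp)).differentiableAt
    have hL : DifferentiableAt ℝ (fun t : ℝ => t • v) 0 := differentiableAt_id.smul_const _
    have hcomp : DifferentiableAt ℝ
        ((fun Y : H.lie.toSubmodule => φ (g * ι (H.expMem ⟨Y, Y.2⟩))) ∘ fun t : ℝ => t • v) 0 :=
      hF.comp 0 hL
    exact hcomp
  exact hd.hasDerivAt

/-- **The flow derivative of a smooth function at every time**:
`d/dt φ(g ι(exp tX)) = (X φ)(g ι(exp tX))`. Borel–Jacquet 1979, §1.5. [folklore] -/
theorem IsArchSmooth.hasDerivAt_flow {φ : G → ℂ} (hφ : IsArchSmooth ι φ) (X : H.lie) (g : G)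
    (s : ℝ) :
    HasDerivAt (fun t : ℝ => φ (g * ι (H.expMem (t • X))))
      (lieDeriv ι X φ (g * ι (H.expMem (s • X)))) s :=
  hasDerivAt_flow_of_hasDerivAt_zero ι X (fun y => hφ.hasDerivAt_flow_zero ι X y) g s

/-- Smoothness in the archimedean variable is preserved by left translation. [folklore] -/
theorem IsArchSmooth.comp_mul_left {φ : G → ℂ} (hφ : IsArchSmooth ι φ) (a : G) :
    IsArchSmooth ι fun g => φ (a * g) := by
  intro g
  have h := hφ (a * g)
  simp only [mul_assoc] at h
  exact h

/-- The Lie derivative commutes with left translation: `X (φ(a ·)) (g) = (X φ)(a g)`. [folklore] -/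
theorem lieDeriv_comp_mul_left (X : H.lie) (φ : G → ℂ) (a g : G) :
    lieDeriv ι X (fun y => φ (a * y)) g = lieDeriv ι X φ (a * g) := by
  unfold lieDeriv
  simp only [mul_assoc]

/-- Iterated Lie derivatives commute with left translation. [folklore] -/
theorem iterLieDeriv_comp_mul_left (w : List H.lie) (φ : G → ℂ) (a : G) :
    iterLieDeriv ι w (fun y => φ (a * y)) = fun g => iterLieDeriv ι w φ (a * g) := by
  induction w with
  | nil => rfl
  | cons X w ih =>
      funext g
      rw [iterLieDeriv_cons, iterLieDeriv_cons, ih, lieDeriv_comp_mul_left]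

/-- The word action commutes with left translation: `p (φ(a ·)) = (p φ)(a ·)`. [folklore] -/
theorem applyFree_comp_mul_left (p : FreeAlgebra ℝ H.lie) (φ : G → ℂ) (a : G) :
    applyFree ι p (fun y => φ (a * y)) = fun g => applyFree ι p φ (a * g) := by
  unfold applyFree
  funext g
  simp only [Finsupp.sum, Finset.sum_apply, Pi.smul_apply, iterLieDeriv_comp_mul_left]

end Flow

/-! ### 2. Parametric integrals over a compact space -/

section Integral

variable {C : Type*} [TopologicalSpace C] [CompactSpace C] [MeasurableSpace C]
  [OpensMeasurableSpace C] (μ : Measure C) [IsFiniteMeasure μ]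
  [TopologicalSpace G]

omit [Group G] [TopologicalSpace G] in
/-- **Averages of jointly continuous families are continuous**: if `(u, g) ↦ F u g` is continuous
on `C × Y` (`C` compact, `Y` locally compact and first countable), then `g ↦ ∫ F u g dμ(u)` is
continuous (Mathlib `continuous_parametric_integral_of_continuous`). [folklore] -/
theorem continuous_integral_of_continuous_uncurry {Y : Type*} [TopologicalSpace Y]
    [FirstCountableTopology Y] [LocallyCompactSpace Y]
    {F : C → Y → ℂ} (hF : Continuous fun p : C × Y => F p.1 p.2) :
    Continuous fun g => ∫ u, F u g ∂μ := by
  have h := continuous_parametric_integral_of_continuous (μ := μ) (f := fun g u => F u g)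
    (hF.comp (continuous_snd.prodMk continuous_fst)) isCompact_univ
  simp only [Measure.restrict_univ] at h
  exact h

variable [IsTopologicalGroup G] (hι : Continuous ι)
include hι

/-- **Differentiation under the integral sign along an archimedean flow.** Let `F, F' : C → G → ℂ`
be jointly continuous, and suppose that for all `u, y` the function `t ↦ F u (y ι(exp tX))` has
derivative `F' u y` at `t = 0`. Then `t ↦ ∫ F u (g ι(exp tX)) dμ(u)` has derivative
`∫ F' u (g ι(exp sX)) dμ(u)` at every `s` (dominated differentiation: the derivatives
`F' u (g ι(exp tX))` are bounded on the compact `C × [s-1, s+1]`). This is the differentiation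
under the integral over `V_{i-1}(𝔸)V_i(k)\V_i(𝔸)` in Moeglin–Waldspurger's I.2.10.
[cite: MoeglinWaldspurger1995, I.2.10] -/
theorem hasDerivAt_integral_flow (X : H.lie) {F F' : C → G → ℂ}
    (hF : Continuous fun p : C × G => F p.1 p.2) (hF' : Continuous fun p : C × G => F' p.1 p.2)
    (hflow : ∀ u y, HasDerivAt (fun t : ℝ => F u (y * ι (H.expMem (t • X)))) (F' u y) 0)
    (g : G) (s : ℝ) :
    HasDerivAt (fun t : ℝ => ∫ u, F u (g * ι (H.expMem (t • X))) ∂μ)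
      (∫ u, F' u (g * ι (H.expMem (s • X))) ∂μ) s := by
  -- the flow and its continuity
  set γ : ℝ → G := fun t => g * ι (H.expMem (t • X)) with hγ
  have hγc : Continuous γ := continuous_const.mul (hι.comp (continuous_expMem_smul X))
  -- continuity of the two families along the flow, in `(u, t)`
  have hFc : Continuous fun p : C × ℝ => F p.1 (γ p.2) :=
    hF.comp (continuous_fst.prodMk (hγc.comp continuous_snd))
  have hF'c : Continuous fun p : C × ℝ => F' p.1 (γ p.2) :=
    hF'.comp (continuous_fst.prodMk (hγc.comp continuous_snd))
  -- a bound for `F'` on `C × closedBall s 1`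
  obtain ⟨M, hM⟩ : ∃ M : ℝ, ∀ p ∈ (univ : Set C) ×ˢ closedBall s 1, ‖F' p.1 (γ p.2)‖ ≤ M := by
    have hK : IsCompact ((univ : Set C) ×ˢ closedBall s 1) :=
      isCompact_univ.prod (isCompact_closedBall s 1)
    obtain ⟨M, hM⟩ := hK.exists_bound_of_continuousOn hF'c.continuousOn
    exact ⟨M, hM⟩
  have hmeas : ∀ t : ℝ, AEStronglyMeasurable (fun u : C => F u (γ t)) μ := fun t =>
    (hFc.comp (continuous_id.prodMk continuous_const)).aestronglyMeasurable
  have hmeas' : ∀ t : ℝ, AEStronglyMeasurable (fun u : C => F' u (γ t)) μ := fun t =>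
    (hF'c.comp (continuous_id.prodMk continuous_const)).aestronglyMeasurable
  have hint : Integrable (fun u : C => F u (γ s)) μ :=
    (hFc.comp (continuous_id.prodMk continuous_const)).integrable_of_hasCompactSupport
      (HasCompactSupport.of_compactSpace _)
  have h := hasDerivAt_integral_of_dominated_loc_of_deriv_le (μ := μ) (x₀ := s)
    (F := fun t u => F u (γ t)) (bound := fun _ => M) (closedBall_mem_nhds s one_pos)
    (Eventually.of_forall hmeas) hint (F' := fun t u => F' u (γ t)) (hmeas' s)
    (Eventually.of_forall fun u t ht => hM ⟨u, t⟩ (mk_mem_prod (mem_univ u) ht))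
    (integrable_const M)
    (Eventually.of_forall fun u t _ => hasDerivAt_flow_of_hasDerivAt_zero ι X (hflow u) g t)
  exact h.2

/-- **The Lie derivative of an average is the average of the flow derivatives**:
`X (g ↦ ∫ F u g dμ(u)) (g) = ∫ F' u g dμ(u)` under the hypotheses of `hasDerivAt_integral_flow`.
[cite: MoeglinWaldspurger1995, I.2.10] -/
theorem lieDeriv_integral_eq_integral (X : H.lie) {F F' : C → G → ℂ}
    (hF : Continuous fun p : C × G => F p.1 p.2) (hF' : Continuous fun p : C × G => F' p.1 p.2)
    (hflow : ∀ u y, HasDerivAt (fun t : ℝ => F u (y * ι (H.expMem (t • X)))) (F' u y) 0)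
    (g : G) :
    lieDeriv ι X (fun y => ∫ u, F u y ∂μ) g = ∫ u, F' u g ∂μ := by
  have h := hasDerivAt_integral_flow ι μ hι X hF hF' hflow g 0
  rw [expMem_zero_smul', map_one, mul_one] at h
  unfold lieDeriv
  exact h.deriv

/-- **Flow derivative of an average at time `0`** (the form consumed by the next application of
`hasDerivAt_integral_flow` when the averaging is iterated). [cite: MoeglinWaldspurger1995, I.2.10] -/
theorem hasDerivAt_integral_flow_zero (X : H.lie) {F F' : C → G → ℂ}
    (hF : Continuous fun p : C × G => F p.1 p.2) (hF' : Continuous fun p : C × G => F' p.1 p.2)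
    (hflow : ∀ u y, HasDerivAt (fun t : ℝ => F u (y * ι (H.expMem (t • X)))) (F' u y) 0)
    (g : G) :
    HasDerivAt (fun t : ℝ => ∫ u, F u (g * ι (H.expMem (t • X))) ∂μ) (∫ u, F' u g ∂μ) 0 := by
  have h := hasDerivAt_integral_flow ι μ hι X hF hF' hflow g 0
  rw [expMem_zero_smul', map_one, mul_one] at h
  exact h

end Integral

end Literature.NumberTheory.Automorphic
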